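import Summits.CriticalPhenomena.PercolationContinuityZ3.Theorems.FK.IsingPlusStateCLT
import Summits.CriticalPhenomena.PercolationContinuityZ3.Theorems.FK.IsingLocalObservableCLT
import Literature.Probability.LatticeModels.GHSInequality
import HarnessLib

/-!
# FINITE SUSCEPTIBILITY IN A POSITIVE FIELD BY GHS, AND NEWMAN'S CLT FOR THE ISING MODEL AT EVERY `β > 0`, `h > 0`:
# `Σ_z ⟨σ_0;σ_z⟩⁺_{β,h} ≤ 4/(βh)` and `(M_n − |Λ_n| m(β,h))/√|Λ_n| ⇒ N(0, χ⁺(β,h))` (Ellis 2006, Thm. V.7.2 (b) + (a))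

Claimed R42 (8)(c) in the cell INBOX at 2026-08-28T18:14:08Z by fkp-10a gen 355 (NEW CLAIM #2 of the gen), addressed to coordinator fk-4 (next seated gen; (ι) in force for windows); lineage row FO-10a-g355l (self-suggested), package g355-isinglocal, label IM-F.
Helper file of the `fk-continuity` build cell (bschramm lane; `--supports stmt-CriticalPhenomena-4575`); builds on
p205010 (kernel theorem, internal audit signed; external expert review pending). No definitions, no named facts, no
sorries; standard axioms. UNCONDITIONAL.

Ellis 2006, Thm. V.7.2 (b): "`σ²(β,h)` is finite for all `β > 0` and `h ≠ 0`" (there via Lemma V.7.4, `σ² ≤ β⁻¹χ`).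
Here by the GHS inequality in finite volume, all inputs being tree theorems (`GHSInequality.lean`):
`d/dh ⟨σ_x⟩⁺_{Λ;β,h} = β Σ_{y∈Λ} ⟨σ_x;σ_y⟩⁺_{Λ;β,h}` (`hasDerivAt_isingExpect_spinAt_field`, Friedli–Velenik Lemma 3.31) is
NON-INCREASING in `h ≥ 0` (GHS: `antitoneOn_isingTrunc_field`, Lebowitz 1974), so by the mean value theorem on `[h/2, h]`
`β Σ_{y∈Λ} ⟨σ_x;σ_y⟩⁺_{Λ;β,h} ≤ (⟨σ_x⟩_h − ⟨σ_x⟩_{h/2})/(h/2) ≤ 4/h`, uniformly in the volume; every truncated term is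
`≥ 0` (FKG), so the bound passes to finite partial sums and to the infinite-volume plus state (`tendsto_isingCorr_plus_box`):
**`Σ_{y∈F} ⟨σ_0;σ_y⟩⁺_{β,h} ≤ 4/(βh)` for every finite `F`**, whence summability and, by the companion files' generic
Newman CLTs (`tendstoInDistribution_magnetization_plus_of_summable`, `tendstoInDistribution_localObservable_of_summable`),
the CLT for the magnetisation and for every local observable at `(β, h)`, `β > 0`, `h > 0`, in every dimension `d ≥ 1`.

* `isingExpect_spinAt_mul_sub_nonneg` — `⟨σ_xσ_y⟩ − ⟨σ_x⟩⟨σ_y⟩ ≥ 0` in finite volume (FKG, `β ≥ 0`).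
* `mul_sum_isingTrunc_le_four_div` — **`β Σ_{y∈Λ} ⟨σ_x;σ_y⟩^{bc}_{Λ;β,h} ≤ 4/h`** (`bc ∈ {free, +}`, `β ≥ 0`, `h > 0`, `x ∈ Λ`).
* `sum_plusTruncated_le_of_pos_field` — `Σ_{y∈F} (⟨σ_{{0}∆{y}}⟩⁺_{β,h} − ⟨σ_0⟩⁺⟨σ_y⟩⁺) ≤ 4/(βh)` for all finite `F`.
* **`summable_plusTruncated_of_pos_field`**, `tsum_plusTruncated_le_of_pos_field` — Ellis V.7.2 (b): `χ⁺(β,h) ≤ 4/(βh) < ∞`.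
* **`tendstoInDistribution_magnetization_plus_of_pos_field`** — Ellis V.7.2 (a) at `h > 0`:
  `(M_n − |Λ_n| m(β,h))/√|Λ_n| ⇒ N(0, χ⁺(β,h))`, `m(β,h) = magnetizationInField d β h`, every `d ≥ 1`, `β > 0`, `h > 0`.
* **`tendstoInDistribution_localObservable_plus_of_pos_field`** — the same for every local observable `f`.
* `exists_plusState_tendstoInDistribution_magnetization_of_pos_field` — non-vacuity (`exists_plusMeasure_holds`).

## References

* R. S. Ellis, *Entropy, Large Deviations, and Statistical Mechanics*, Springer 2006, Thm. V.7.2 and Lemma V.7.4. [Ellis2006]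
* C. M. Newman, Comm. Math. Phys. 74 (1980) 119–128, Thm. 2. [Newman1980]
* R. B. Griffiths, C. A. Hurst, S. Sherman, J. Math. Phys. 11 (1970) 790–795; J. L. Lebowitz, Comm. Math. Phys. 35 (1974)
  87–92; S. Friedli, Y. Velenik, CUP 2017, Lemma 3.31, Remark 3.41. [Lebowitz1974] [FriedliVelenik2017]
-/

noncomputable section

namespace Summit.CriticalPhenomena.PercolationContinuityZ3.Theorems.FK

namespace IsingCLT

open MeasureTheory ProbabilityTheory Filter Topology Finset Set
open scoped symmDiff
open Literature.Probability.Percolation Literature.Probability.LatticeModels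
open Summit.CriticalPhenomena.PercolationContinuityZ3.Theorems.FK.NewmanCLT

variable {d : ℕ}

/-! ### Finite volume: GHS bound on the field derivative of the magnetisation -/

section FiniteVolume

variable {V : Type*} (G : SimpleGraph V) [DecidableEq V] [G.LocallyFinite]

/-- **Truncated two-point functions are nonnegative in finite volume** (FKG / GKS II: spins are increasing; `β ≥ 0`, any
field and boundary condition): `⟨σ_xσ_y⟩^{bc}_{Λ;β,h} − ⟨σ_x⟩⟨σ_y⟩ ≥ 0`. [cite: FriedliVelenik2017, Thm. 3.21] -/
theorem isingExpect_spinAt_mul_sub_nonneg (Λ : Finset V) {β : ℝ} (hβ : 0 ≤ β) (h : ℝ) (bc : BoundaryCondition V)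
    (x y : V) :
    0 ≤ isingExpect G Λ β h bc (fun σ => spinAt x σ * spinAt y σ) -
      isingExpect G Λ β h bc (spinAt x) * isingExpect G Λ β h bc (spinAt y) :=
  sub_nonneg.2 (ising_fkg_holds G hβ Λ h bc (spinAt x) (spinAt y) (spinAt_mono x) (spinAt_mono y)
    (measurable_spinAt x) (measurable_spinAt y))

/-- **GHS BOUND ON THE SUSCEPTIBILITY IN A POSITIVE FIELD, finite volume**: for `bc ∈ {free, +}`, `β ≥ 0`, `h > 0`, `x ∈ Λ`:
`β Σ_{y∈Λ} (⟨σ_xσ_y⟩ − ⟨σ_x⟩⟨σ_y⟩)^{bc}_{Λ;β,h} ≤ 4/h`. The left side is `d/dh ⟨σ_x⟩` (Friedli–Velenik Lemma 3.31), a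
non-increasing function of `h ≥ 0` (GHS), so it is at most the slope of `⟨σ_x⟩ ∈ [−1,1]` over `[h/2, h]` (mean value
theorem). [cite: Ellis2006, Lemma V.7.4; FriedliVelenik2017, Lemma 3.31 and Remark 3.41; Lebowitz1974, Remark (ii)] -/
theorem mul_sum_isingTrunc_le_four_div {Λ : Finset V} {β : ℝ} (hβ : 0 ≤ β) {h : ℝ} (hh : 0 < h)
    {bc : BoundaryCondition V} (hbc : bc = .free ∨ bc = .plus) {x : V} (hx : x ∈ Λ) :
    β * ∑ y ∈ Λ, (isingExpect G Λ β h bc (fun σ => spinAt x σ * spinAt y σ) -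
        isingExpect G Λ β h bc (spinAt x) * isingExpect G Λ β h bc (spinAt y)) ≤ 4 / h := by
  set f : ℝ → ℝ := fun t => isingExpect G Λ β t bc (spinAt x) with hf
  set f' : ℝ → ℝ := fun t => β * ∑ y ∈ Λ, (isingExpect G Λ β t bc (fun σ => spinAt x σ * spinAt y σ) -
    isingExpect G Λ β t bc (spinAt x) * isingExpect G Λ β t bc (spinAt y)) with hf'
  have hderiv : ∀ t, HasDerivAt f (f' t) t := fun t => hasDerivAt_isingExpect_spinAt_field G Λ β t bc x
  have hanti : AntitoneOn f' (Ici 0) := by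
    intro a ha b hb hab
    simp only [hf']
    refine mul_le_mul_of_nonneg_left (Finset.sum_le_sum fun y hy => ?_) hβ
    exact antitoneOn_isingTrunc_field G hβ hbc hx hy ha hb hab
  have hab : h / 2 < h := by linarith
  obtain ⟨c, hc, hslope⟩ := exists_hasDerivAt_eq_slope f f' hab
    (fun t _ => (hderiv t).continuousAt.continuousWithinAt) (fun t _ => hderiv t)
  have hc0 : (0 : ℝ) ≤ c := by linarith [hc.1]
  have hfb : ∀ t, |f t| ≤ 1 := fun t => by
    have := abs_isingCorr_le_one G Λ β t bc {x}
    simpa only [isingCorr, spinProduct_singleton] using this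
  have h1 : f' h ≤ f' c := hanti hc0 hh.le hc.2.le
  have h2 : f' c ≤ 4 / h := by
    rw [hslope, div_le_div_iff₀ (by linarith) hh]
    have ha := hfb h
    have hb := hfb (h / 2)
    rw [abs_le] at ha hb
    nlinarith
  exact h1.trans h2

/-- **Partial sums**: for `F ⊆ Λ`, `β Σ_{y∈F} ⟨σ_x;σ_y⟩^{bc}_{Λ;β,h} ≤ 4/h` (drop the other nonnegative terms).
[cite: Ellis2006, Lemma V.7.4] -/
theorem mul_sum_isingTrunc_le_four_div_of_subset {Λ F : Finset V} (hF : F ⊆ Λ) {β : ℝ} (hβ : 0 ≤ β) {h : ℝ}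
    (hh : 0 < h) {bc : BoundaryCondition V} (hbc : bc = .free ∨ bc = .plus) {x : V} (hx : x ∈ Λ) :
    β * ∑ y ∈ F, (isingExpect G Λ β h bc (fun σ => spinAt x σ * spinAt y σ) -
        isingExpect G Λ β h bc (spinAt x) * isingExpect G Λ β h bc (spinAt y)) ≤ 4 / h := by
  refine le_trans (mul_le_mul_of_nonneg_left (Finset.sum_le_sum_of_subset_of_nonneg hF fun y _ _ =>
    isingExpect_spinAt_mul_sub_nonneg G Λ hβ h bc x y) hβ) (mul_sum_isingTrunc_le_four_div G hβ hh hbc hx)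

end FiniteVolume

/-! ### Infinite volume: `χ⁺(β,h) ≤ 4/(βh)` -/

/-- The finite-volume truncated function in the tree's set notation: `⟨σ_0σ_y⟩ − ⟨σ_0⟩⟨σ_y⟩ =
⟨σ_{{0}∆{y}}⟩ − ⟨σ_{{0}}⟩⟨σ_{{y}}⟩`. [folklore] -/
theorem isingTrunc_eq_isingCorr {V : Type*} (G : SimpleGraph V) [DecidableEq V] [G.LocallyFinite] (Λ : Finset V)
    (β h : ℝ) (bc : BoundaryCondition V) (x y : V) :
    isingExpect G Λ β h bc (fun σ => spinAt x σ * spinAt y σ) -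
        isingExpect G Λ β h bc (spinAt x) * isingExpect G Λ β h bc (spinAt y) =
      isingCorr G Λ β h bc ({x} ∆ {y}) - isingCorr G Λ β h bc {x} * isingCorr G Λ β h bc {y} := by
  simp only [isingCorr, spinProduct_singleton]
  congr 2
  exact spinPair_eq_spinProduct_symmDiff x y

/-- **`Σ_{y∈F} ⟨σ_0;σ_y⟩⁺_{β,h} ≤ 4/(βh)` for every finite `F ⊆ ℤ^d`** (`β > 0`, `h > 0`): the finite-volume GHS bound
passed to the plus state along the boxes (`tendsto_isingCorr_plus_box`). [cite: Ellis2006, Thm. V.7.2 (b) and Lemma V.7.4] -/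
theorem sum_plusTruncated_le_of_pos_field {β h : ℝ} (hβ : 0 < β) (hh : 0 < h) (F : Finset (Site d)) :
    ∑ y ∈ F, (plusCorr d β h ({0} ∆ {y}) - plusCorr d β h {0} * plusCorr d β h {y}) ≤ 4 / (β * h) := by
  classical
  have hlim : Tendsto (fun L : ℕ => ∑ y ∈ F, (isingCorr (zdGraph d) (box d L) β h .plus ({0} ∆ {y}) -
      isingCorr (zdGraph d) (box d L) β h .plus {0} * isingCorr (zdGraph d) (box d L) β h .plus {y})) atTop
      (𝓝 (∑ y ∈ F, (plusCorr d β h ({0} ∆ {y}) - plusCorr d β h {0} * plusCorr d β h {y}))) :=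
    tendsto_finsetSum _ fun y _ => (tendsto_isingCorr_plus_box hβ.le h _).sub
      ((tendsto_isingCorr_plus_box hβ.le h _).mul (tendsto_isingCorr_plus_box hβ.le h _))
  obtain ⟨L₀, hL₀⟩ := exists_forall_subset_box d (insert (0 : Site d) F)
  refine le_of_tendsto hlim (eventually_atTop.2 ⟨L₀, fun L hL => ?_⟩)
  have hsub := hL₀ L hL
  have h0 : (0 : Site d) ∈ box d L := hsub (Finset.mem_insert_self _ _)
  have hF : F ⊆ box d L := fun y hy => hsub (Finset.mem_insert_of_mem hy)
  have key := mul_sum_isingTrunc_le_four_div_of_subset (zdGraph d) hF hβ.le hh (Or.inr rfl) h0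
  simp_rw [isingTrunc_eq_isingCorr] at key
  rw [le_div_iff₀ (mul_pos hβ hh)]
  calc (∑ y ∈ F, (isingCorr (zdGraph d) (box d L) β h .plus ({0} ∆ {y}) -
          isingCorr (zdGraph d) (box d L) β h .plus {0} * isingCorr (zdGraph d) (box d L) β h .plus {y})) * (β * h)
        = (β * ∑ y ∈ F, (isingCorr (zdGraph d) (box d L) β h .plus ({0} ∆ {y}) -
          isingCorr (zdGraph d) (box d L) β h .plus {0} * isingCorr (zdGraph d) (box d L) β h .plus {y})) * h := by ring
    _ ≤ 4 / h * h := mul_le_mul_of_nonneg_right key hh.le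
    _ = 4 := div_mul_cancel₀ _ hh.ne'

/-- **ELLIS 2006, THM. V.7.2 (b): FINITE SUSCEPTIBILITY IN A POSITIVE FIELD** — for the nearest-neighbour Ising model on
`ℤ^d` (every `d`), `β > 0`, `h > 0`: `z ↦ ⟨σ_0σ_z⟩⁺_{β,h} − ⟨σ_0⟩⁺⟨σ_z⟩⁺` is summable (terms `≥ 0` by FKG in the plus
state, partial sums `≤ 4/(βh)` by GHS). [cite: Ellis2006, Thm. V.7.2 (b); Lebowitz1974, Remark (ii)] -/
theorem summable_plusTruncated_of_pos_field {β h : ℝ} (hβ : 0 < β) (hh : 0 < h) :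
    Summable fun z : Site d => plusCorr d β h ({0} ∆ {z}) - plusCorr d β h {0} * plusCorr d β h {z} := by
  classical
  obtain ⟨μ, hμG, -, hμc⟩ := exists_plusMeasure_holds (d := d) (β := β) (h := h) hβ.le
  haveI : IsProbabilityMeasure μ := ((mem_isingGibbsMeasures_iff d β h μ).1 hμG).isProbabilityMeasure
  have h0 : ∀ z : Site d, 0 ≤ plusCorr d β h ({0} ∆ {z}) - plusCorr d β h {0} * plusCorr d β h {z} := fun z => by
    have hz := covariance_spinAt_eq_plusTruncated hβ.le hμc 0 z
    rw [sub_zero] at hz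
    rw [← hz]
    exact covariance_nonneg_of_monotone (isPositivelyAssociated_of_spinCorr_eq_plusCorr hβ.le h μ hμc) (spinAt_mono 0)
      (spinAt_mono z) (measurable_spinAt 0) (measurable_spinAt z) ⟨1, abs_spinAt_le_one 0⟩ ⟨1, abs_spinAt_le_one z⟩
  exact summable_of_sum_le h0 fun F => sum_plusTruncated_le_of_pos_field hβ hh F

/-- **`χ⁺(β,h) = Σ_z ⟨σ_0;σ_z⟩⁺_{β,h} ≤ 4/(βh)`** (`β > 0`, `h > 0`). [cite: Ellis2006, Thm. V.7.2 (b) and Lemma V.7.4] -/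
theorem tsum_plusTruncated_le_of_pos_field {β h : ℝ} (hβ : 0 < β) (hh : 0 < h) :
    ∑' z : Site d, (plusCorr d β h ({0} ∆ {z}) - plusCorr d β h {0} * plusCorr d β h {z}) ≤ 4 / (β * h) :=
  (summable_plusTruncated_of_pos_field hβ hh).tsum_le_of_sum_le fun F => sum_plusTruncated_le_of_pos_field hβ hh F

/-! ### THE CENTRAL LIMIT THEOREMS AT `h > 0` -/

/-- **CENTRAL LIMIT THEOREM FOR THE ISING MAGNETISATION IN A POSITIVE FIELD** (Ellis 2006, Thm. V.7.2 (a)+(b); Newman 1980,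
Thm. 2 — UNCONDITIONAL, every dimension `d ≥ 1`): for `β > 0`, `h > 0` and the plus state `μ` (`∫ σ_A dμ = ⟨σ_A⟩⁺_{β,h}`;
`exists_plusMeasure_holds`), with `M_n = Σ_{x∈Λ_n} σ_x` and `m(β,h) = magnetizationInField d β h = ⟨σ_0⟩⁺_{β,h}`:

`(M_n − |Λ_n| m(β,h)) / √|Λ_n| → N(0, χ⁺(β,h))` in distribution, `χ⁺(β,h) = Σ_z ⟨σ_0;σ_z⟩⁺_{β,h} ≤ 4/(βh)`

(for any `Y ~ gaussianReal 0 v`, `v = χ⁺(β,h)`; `χ⁺ ≥ 1 − m(β,h)²` by `one_sub_sq_le_tsum_plusTruncated`).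
[cite: Ellis2006, Thm. V.7.2; Newman1980, Thm. 2] -/
theorem tendstoInDistribution_magnetization_plus_of_pos_field {Ω' : Type*} {mΩ' : MeasurableSpace Ω'}
    {P' : Measure Ω'} [IsProbabilityMeasure P'] {Y : Ω' → ℝ} (hd : 1 ≤ d) {β h : ℝ} (hβ : 0 < β) (hh : 0 < h)
    (μ : Measure (SpinConfig (Site d))) [IsProbabilityMeasure μ]
    (hμ : ∀ A : Finset (Site d), spinCorr μ A = plusCorr d β h A) {v : NNReal}
    (hv : (v : ℝ) = ∑' z : Site d, (plusCorr d β h ({0} ∆ {z}) - plusCorr d β h {0} * plusCorr d β h {z}))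
    (hY : HasLaw Y (gaussianReal 0 v) P') :
    TendstoInDistribution (fun (n : ℕ) (σ : SpinConfig (Site d)) => (Real.sqrt #(box d n))⁻¹ *
        (∑ z ∈ box d n, spinAt z σ - #(box d n) * magnetizationInField d β h)) atTop Y (fun _ => μ) P' := by
  have hm : magnetizationInField d β h = plusCorr d β h {0} := by
    simp only [magnetizationInField, plusCorr, spinProduct_singleton]
  rw [hm]
  exact tendstoInDistribution_magnetization_plus_of_summable hd hβ.le hμ (summable_plusTruncated_of_pos_field hβ hh) hv hY

/-- **CLT FOR EVERY LOCAL OBSERVABLE OF THE ISING MODEL IN A POSITIVE FIELD** (Newman 1980 / 1983 with Ellis V.7.2 (b);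
UNCONDITIONAL, every `d ≥ 1`): for `β > 0`, `h > 0`, the plus state `μ` and `f` depending on finitely many spins:
`|Λ_n|^{-1/2} Σ_{z∈Λ_n} (f∘θ_{−z} − E⁺_{β,h} f) ⇒ N(0, Σ_z Cov⁺_{β,h}(f, f∘θ_{−z}))`.
[cite: Newman1980, Thm. 2 and remark after (12); Ellis2006, Thm. V.7.2] -/
theorem tendstoInDistribution_localObservable_plus_of_pos_field {Ω' : Type*} {mΩ' : MeasurableSpace Ω'}
    {P' : Measure Ω'} [IsProbabilityMeasure P'] {Y : Ω' → ℝ} (hd : 1 ≤ d) {β h : ℝ} (hβ : 0 < β) (hh : 0 < h)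
    (μ : Measure (SpinConfig (Site d))) [IsProbabilityMeasure μ]
    (hμ : ∀ A : Finset (Site d), spinCorr μ A = plusCorr d β h A) {f : SpinConfig (Site d) → ℝ}
    {D : Finset (Site d)} (hf : DependsOn f (↑D : Set (Site d))) {v : NNReal}
    (hv : (v : ℝ) = ∑' z : Site d, cov[f, fun σ => f (configShift (-z) σ); μ])
    (hY : HasLaw Y (gaussianReal 0 v) P') :
    TendstoInDistribution (fun (n : ℕ) (σ : SpinConfig (Site d)) => (Real.sqrt #(box d n))⁻¹ *
        (∑ z ∈ box d n, f (configShift (-z) σ) - #(box d n) * ∫ σ', f σ' ∂μ)) atTop Y (fun _ => μ) P' := by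
  classical
  have hT := isTranslationInvariantMeasure_of_spinCorr_eq_plusCorr hβ.le hμ
  have hsum : Summable fun z : Site d => cov[spinAt 0, spinAt z; μ] := by
    simp_rw [covariance_spinAt_eq_plusTruncated hβ.le hμ, sub_zero]
    exact summable_plusTruncated_of_pos_field hβ hh
  have key := tendstoInDistribution_localObservable_of_summable hd
    (isPositivelyAssociated_of_spinCorr_eq_plusCorr hβ.le h μ hμ) hT hsum hf hv hY
  have hfm : Measurable f := hf.measurable_of_finset D
  obtain ⟨B, hB⟩ := hf.exists_bound_of_finset D
  have hmean : ∀ n : ℕ, ∫ σ', ∑ z ∈ box d n, f (configShift (-z) σ') ∂μ = #(box d n) * ∫ σ', f σ' ∂μ := by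
    intro n
    have hXm : ∀ z : Site d, Measurable fun σ : SpinConfig (Site d) => f (configShift (-z) σ) := fun z =>
      hfm.comp (configShift (-z)).measurable
    rw [integral_finsetSum _ fun z _ => integrable_of_abs_le (hXm z) (fun σ => hB _)]
    have hz : ∀ z : Site d, ∫ σ', f (configShift (-z) σ') ∂μ = ∫ σ', f σ' ∂μ := fun z => by
      conv_rhs => rw [← hT (-z)]
      rw [integral_map_equiv]
    simp only [hz, Finset.sum_const, nsmul_eq_mul]
  simp only [hmean] at key
  exact key

/-- **The positive-field CLT with the plus state supplied** (non-vacuity; the state at `h > 0` is the unique Gibbs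
measure, here produced by `exists_plusMeasure_holds`): for every `d ≥ 1`, `β > 0`, `h > 0`.
[cite: Ellis2006, Thm. V.7.2; FriedliVelenik2017, Thm. 3.17 and Thm. 6.26] -/
theorem exists_plusState_tendstoInDistribution_magnetization_of_pos_field {Ω' : Type*} {mΩ' : MeasurableSpace Ω'}
    {P' : Measure Ω'} [IsProbabilityMeasure P'] {Y : Ω' → ℝ} (hd : 1 ≤ d) {β h : ℝ} (hβ : 0 < β) (hh : 0 < h)
    {v : NNReal}
    (hv : (v : ℝ) = ∑' z : Site d, (plusCorr d β h ({0} ∆ {z}) - plusCorr d β h {0} * plusCorr d β h {z}))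
    (hY : HasLaw Y (gaussianReal 0 v) P') :
    ∃ (μ : Measure (SpinConfig (Site d))) (_ : IsProbabilityMeasure μ), μ ∈ isingGibbsMeasures d β h ∧
      IsTranslationInvariantMeasure μ ∧ (∀ A : Finset (Site d), spinCorr μ A = plusCorr d β h A) ∧
      TendstoInDistribution (fun (n : ℕ) (σ : SpinConfig (Site d)) => (Real.sqrt #(box d n))⁻¹ *
        (∑ z ∈ box d n, spinAt z σ - #(box d n) * magnetizationInField d β h)) atTop Y (fun _ => μ) P' := by
  obtain ⟨μ, hμG, hμT, hμc⟩ := exists_plusMeasure_holds (d := d) (β := β) (h := h) hβ.le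
  haveI : IsProbabilityMeasure μ := ((mem_isingGibbsMeasures_iff d β h μ).1 hμG).isProbabilityMeasure
  exact ⟨μ, inferInstance, hμG, hμT, hμc,
    tendstoInDistribution_magnetization_plus_of_pos_field hd hβ hh μ hμc hv hY⟩

end IsingCLT

end Summit.CriticalPhenomena.PercolationContinuityZ3.Theorems.FK

end
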